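import Summits.Ventures.PercRepro.C041SeedCoverBulk
import Summits.Ventures.PercRepro.C041SeedCoverBox9
import Summits.Ventures.PercRepro.C041SeedCoverBox10
import Summits.Ventures.PercRepro.C041SeedCoverBox11
import Summits.Ventures.PercRepro.C041SeedCoverBox12
import Summits.Ventures.PercRepro.C041SeedCoverBox13
import Summits.Ventures.PercRepro.C041SeedCoverBox14
import Summits.Ventures.PercRepro.C041SeedCoverBox15

/-!
# THE LAST SEED ON THE HALF-SQUARE `A, B ≤ 1/2` (mine-3, gen 64; C-041.md §21 (ay) addendum 4)

The two strips `A ≤ 1/20` (`InCone_thetaTri_v1_V_stripA`) and `B ≤ 1/20, A ≤ 3/10` (`InCone_thetaTri_v1_V_stripB`) of the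
lower-frontier cover, assembled from the strip box theorems `C041SeedCoverBox9`–`14`, and their union with the bulk theorem
(`C041SeedCoverBulk`) and the corner box `C041SeedCoverBox15`: every star with `m ≥ 2` leaves whose invariants satisfy
`A, B ≤ 1/2` and `6/5 ≤ P₁ ≤ 9/2` has `θ_△(v 1, V a) ∈ cone`, except possibly in the corner `A > 3/10, B ≤ 1/20, P₁ > 79/20`
(`InCone_thetaTri_v1_V_half`); in particular for every such star with `P₁ ≤ 79/20` (`InCone_thetaTri_v1_V_half_low`).  In the
corner `A ≥ 3/10, B ≤ 1/20` no star has `P₁ ≤ 8/5` (`half_corner_P1`: the mirror hyperbola forces `P₂ ≥ 361/160` while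
`P₂² A ≤ 1` caps `P₂ ≤ √(10/3)`), which is why the corner box starts at `P₁ = 8/5`.
-/

namespace PercRepro

namespace RelaxedTriangle

open TreeClosure

/-- In the corner `A ≥ 3/10`, `B ≤ 1/20` no star has `P₁ ≤ 8/5`: `(3/2)(1 − B)² ≤ P₂(P₁ − 1)` forces `P₂ ≥ 361/160`, while
`P₂² A ≤ 1` gives `P₂² ≤ 10/3 < (361/160)²`. -/
theorem half_corner_P1 (P1 P2 A B : ℝ) (hA0 : 3 / 10 ≤ A) (hB1 : B ≤ 1 / 20) (hP2 : 0 ≤ P2)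
    (hRm : 3 / 2 * (1 - B) ^ 2 ≤ P2 * (P1 - 1)) (hu2 : P2 ^ 2 * A ≤ 1) : 8 / 5 < P1 := by
  by_contra hlow
  have hlow : P1 ≤ 8 / 5 := not_lt.mp hlow
  have hBq : (19 / 20 : ℝ) ^ 2 ≤ (1 - B) ^ 2 := by nlinarith
  have h1 : (3 / 2 : ℝ) * (19 / 20) ^ 2 ≤ P2 * (3 / 5) := by nlinarith [mul_nonneg hP2 (sub_nonneg.2 hlow)]
  have h2 : (361 / 160 : ℝ) ≤ P2 := by linarith
  have h3 : (361 / 160 : ℝ) ^ 2 ≤ P2 ^ 2 := by nlinarith [mul_nonneg (sub_nonneg.2 h2) hP2]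
  have h4 : (361 / 160 : ℝ) ^ 2 * (3 / 10) ≤ P2 ^ 2 * A := mul_le_mul h3 hA0 (by norm_num) (sq_nonneg P2)
  norm_num at h4
  linarith

/-- **THE SEED ON THE STRIP `A ≤ 1/20`.** Every star with `m ≥ 2` leaves, `A ≤ 1/20`, `B ≤ 1/2` and `6/5 ≤ P₁ ≤ 9/2` has
`θ_△(v 1, V a) ∈ cone` (boxes 11, 12, 13, 14; for `B ≥ 3/20` the bound `P₁² B ≤ 1` puts `P₁` inside the shorter boxes). -/
theorem InCone_thetaTri_v1_V_stripA {m : ℕ} (a : Fin (m + 2) → ℝ) (ha : ∀ i, 0 ≤ a i ∧ a i ≤ 1)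
    (hA : ∏ i, a i ≤ 1 / 20) (hB : ∏ i, (1 - a i) ≤ 1 / 2)
    (hP : (6 / 5 : ℝ) ≤ ∏ i, (1 + a i ^ 2) ∧ ∏ i, (1 + a i ^ 2) ≤ 9 / 2) :
    InCone (thetaTri (v 1) (V a)) := by
  have hu1 := prod_one_add_sq_sq_mul_prod_one_sub_le_one a ha
  obtain ⟨hA00, _⟩ := prod_unit_mem a ha
  obtain ⟨hB00, _⟩ := prod_unit_mem (fun i => 1 - a i) (fun i => ⟨by linarith [(ha i).2], by linarith [(ha i).1]⟩)
  have hP0 : (0 : ℝ) ≤ ∏ i, (1 + a i ^ 2) := by linarith [hP.1]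
  rcases le_or_gt (∏ i, (1 - a i)) (1 / 20) with hB1 | hB1
  · exact InCone_thetaTri_v1_V_box11 a ha ⟨hA00, hA⟩ ⟨hB00, hB1⟩ hP
  rcases le_or_gt (∏ i, (1 - a i)) (3 / 20) with hB2 | hB2
  · exact InCone_thetaTri_v1_V_box12 a ha ⟨hA00, hA⟩ ⟨hB1.le, hB2⟩ hP
  rcases le_or_gt (∏ i, (1 - a i)) (3 / 10) with hB3 | hB3
  · exact InCone_thetaTri_v1_V_box13 a ha ⟨hA00, hA⟩ ⟨hB2.le, hB3⟩ ⟨hP.1, bulk_P1_le2 _ _ hP0 hB2.le hu1⟩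
  · exact InCone_thetaTri_v1_V_box14 a ha ⟨hA00, hA⟩ ⟨hB3.le, hB⟩ ⟨hP.1, bulk_P1_le3 _ _ hP0 hB3.le hu1⟩

/-- **THE SEED ON THE STRIP `B ≤ 1/20`, `A ≤ 3/10`.** Every star with `m ≥ 2` leaves, `A ≤ 3/10`, `B ≤ 1/20` and
`6/5 ≤ P₁ ≤ 9/2` has `θ_△(v 1, V a) ∈ cone` (boxes 11, 9, 10). -/
theorem InCone_thetaTri_v1_V_stripB {m : ℕ} (a : Fin (m + 2) → ℝ) (ha : ∀ i, 0 ≤ a i ∧ a i ≤ 1)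
    (hA : ∏ i, a i ≤ 3 / 10) (hB : ∏ i, (1 - a i) ≤ 1 / 20)
    (hP : (6 / 5 : ℝ) ≤ ∏ i, (1 + a i ^ 2) ∧ ∏ i, (1 + a i ^ 2) ≤ 9 / 2) :
    InCone (thetaTri (v 1) (V a)) := by
  obtain ⟨hA00, _⟩ := prod_unit_mem a ha
  obtain ⟨hB00, _⟩ := prod_unit_mem (fun i => 1 - a i) (fun i => ⟨by linarith [(ha i).2], by linarith [(ha i).1]⟩)
  rcases le_or_gt (∏ i, a i) (1 / 20) with hA1 | hA1
  · exact InCone_thetaTri_v1_V_box11 a ha ⟨hA00, hA1⟩ ⟨hB00, hB⟩ hP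
  rcases le_or_gt (∏ i, a i) (3 / 20) with hA2 | hA2
  · exact InCone_thetaTri_v1_V_box9 a ha ⟨hA1.le, hA2⟩ ⟨hB00, hB⟩ hP
  · exact InCone_thetaTri_v1_V_box10 a ha ⟨hA2.le, hA⟩ ⟨hB00, hB⟩ hP

/-- **THE SEED ON THE HALF-SQUARE OFF THE CORNER.** Every star with `m ≥ 2` leaves, `A ≤ 1/2`, `B ≤ 1/2` and
`6/5 ≤ P₁ ≤ 9/2` has `θ_△(v 1, V a) ∈ cone`, provided that in the corner `A > 3/10`, `B ≤ 1/20` also `P₁ ≤ 79/20`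
(the strips, the bulk theorem and the corner box 15). -/
theorem InCone_thetaTri_v1_V_half {m : ℕ} (a : Fin (m + 2) → ℝ) (ha : ∀ i, 0 ≤ a i ∧ a i ≤ 1)
    (hA : ∏ i, a i ≤ 1 / 2) (hB : ∏ i, (1 - a i) ≤ 1 / 2)
    (hP : (6 / 5 : ℝ) ≤ ∏ i, (1 + a i ^ 2) ∧ ∏ i, (1 + a i ^ 2) ≤ 9 / 2)
    (hc : 3 / 10 < ∏ i, a i → ∏ i, (1 - a i) ≤ 1 / 20 → ∏ i, (1 + a i ^ 2) ≤ 79 / 20) :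
    InCone (thetaTri (v 1) (V a)) := by
  have h2 := one_add_prod_one_sub_sq_le a ha
  have hRm := sharp_R_mirror a ha
  have hu2 := prod_one_add_one_sub_sq_sq_mul_prod_le_one a ha
  obtain ⟨hB00, _⟩ := prod_unit_mem (fun i => 1 - a i) (fun i => ⟨by linarith [(ha i).2], by linarith [(ha i).1]⟩)
  rcases le_or_gt (∏ i, a i) (1 / 20) with hA1 | hA1
  · exact InCone_thetaTri_v1_V_stripA a ha hA1 hB hP
  rcases le_or_gt (∏ i, (1 - a i)) (1 / 20) with hB1 | hB1
  · rcases le_or_gt (∏ i, a i) (3 / 10) with hA3 | hA3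
    · exact InCone_thetaTri_v1_V_stripB a ha hA3 hB1 hP
    · have hP2nn : (0 : ℝ) ≤ ∏ i, (1 + (1 - a i) ^ 2) := bulk_P2_nonneg _ _ h2
      have h85 := half_corner_P1 _ _ _ _ hA3.le hB1 hP2nn hRm hu2
      exact InCone_thetaTri_v1_V_box15 a ha ⟨hA3.le, hA⟩ ⟨hB00, hB1⟩ ⟨h85.le, hc hA3 hB1⟩
  · exact InCone_thetaTri_v1_V_bulk a ha ⟨hA1.le, hA⟩ ⟨hB1.le, hB⟩

/-- **THE SEED ON THE HALF-SQUARE, `P₁ ≤ 79/20`.** Every star with `m ≥ 2` leaves, `A ≤ 1/2`, `B ≤ 1/2` and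
`6/5 ≤ P₁ ≤ 79/20` has `θ_△(v 1, V a) ∈ cone`. -/
theorem InCone_thetaTri_v1_V_half_low {m : ℕ} (a : Fin (m + 2) → ℝ) (ha : ∀ i, 0 ≤ a i ∧ a i ≤ 1)
    (hA : ∏ i, a i ≤ 1 / 2) (hB : ∏ i, (1 - a i) ≤ 1 / 2)
    (hP : (6 / 5 : ℝ) ≤ ∏ i, (1 + a i ^ 2) ∧ ∏ i, (1 + a i ^ 2) ≤ 79 / 20) :
    InCone (thetaTri (v 1) (V a)) :=
  InCone_thetaTri_v1_V_half a ha hA hB ⟨hP.1, by linarith [hP.2]⟩ (fun _ _ => hP.2)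

end RelaxedTriangle

end PercRepro
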